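import Summits.QuantumFields.BalabanUV.T4Continuum.Support.NE3CornerGaugeSpace
import Summits.QuantumFields.BalabanUV.T4Continuum.Support.NE3FrameFreeSliceUnique
import HarnessLib

/-!
# NE3FrameFreeDecomposition (T⁴ programme, node NE3, row Φ6-FLAT of the owner's rulings ρ-g21-3 ∕ ρ-g21-4 (W4), file 3∕3) — THE
# FRAME-FREE DECOMPOSITION OF THE FLAT k-FOLD TANGENT SPACE, EXISTENCE AND UNIQUENESS:
# `ker (Tcoarse L)^[k] ∩ {skew, (N·L^k)-periodic} = dPot Ξ₀^{𝔲(n)} ⊕ frameFreeBlockLandau L N k`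

NE3 (node U1b) formalisation swarm `b2b-balaban-t4-ne3-formalise-*`, leaf seat `b2b-balaban-t4-ne3-formalise-leaf-02` (gen 5),
row **Φ6-flat** (owner design `HOME/t4/b2b-balaban-t4-ne3-p1/g21/D-ne3p1-g21-2.md` §2 «the representative lemma the chart's
`tangent : Ψ 1 ∈ T` needs», ruling ρ-g21-4 (W4)); INTENT in `HOME/CLAIMS.log` 2026-08-20T15:38:09Z; files 1∕2 =
`NE3FrameFreeDecompositionPrep` ∕ `NE3CornerGaugeSpace`.  All [folklore], 0 sorry, 0 def:
§9 `iterate_Tcoarse_sub`, `framePot_sub`, `flatDiv_sub`, **`sub_mem_frameFreeBlockLandau`** (the slice is a subspace);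
§10 **(D) `frameFree_decomposition_unique`**: two corner-trivial `(N·L^k)`-periodic gauges moving one `Y` into the slice have
   the same coboundary — linearity + leaf-01-g5's trivial intersection `NE3FrameFreeSliceUnique.dPot_eq_zero_of_mem_frameFreeBlockLandau`
   (`dPot Ξ₀ ∩ T_♮(1) = {0}`, in tree) BY NAME;
§11 **(E) `exists_cornerGauge_mem_frameFreeBlockLandau`**: for `L, N, k ≥ 1`, `(L^k)^d ≥ 2` and a skew `(N·L^k)`-periodic `Y`
   with `TangentIter L (k−1) flatCfg Y` there is a 𝔲(n)-valued, `(N·L^k)`-periodic, CORNER-TRIVIAL (`ξ (L^k•w) = 0`) gauge `ξ`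
   with `(fun x μ => Y x μ + dPot ξ x μ) ∈ frameFreeBlockLandau L N k`.  Construction: `ξ = frameKill L k Y + η` — Φ1a's
   frame-killing gauge (`NE3FramePotGauge.framePot_add_frameKill`, skew by file 1) followed by the projection step of file 2
   (`NE3CornerGaugeSpace.exists_orthogonal` with `P = N·L^k`, `M = L^k`); tangency survives because both gauges are
   corner-trivial (`iterate_Tcoarse_add_dPot_of_corner`), frame-freeness because `η` has zero block means
   (`framePot_add_dPot_of_corner` + `iterate_bmean_apply`), and `hsR`-orthogonality to `dPot Ξ₀₀^{𝔲(n)}` is the blockwise-constant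
   divergence clause of the slice (`blockConst_of_orthogonal`).
Together with leaf-01-g5's (U) this is the flat decomposition `ker (Tcoarse L)^[k] = dPot Ξ₀ ⊕ T_♮(1)` of ruling ρ-g21-3 (V6) on
skew periodic fields, as the two statements «sum» (E) + «trivial intersection» (U)∕(D); the gauge reading is
`gaugeDir flatCfg ξ = −dPot ξ` (`NE3FrameFreeSliceUnique.gaugeDir_flatCfg_eq_neg_dPot`), so (E) says: every flat k-fold tangent
direction is moved INTO the frame-free block-Landau slice by a linearised corner-trivial 𝔲(n)-gauge transformation — what the
chart's `tangent : Ψ 1 ∈ T` consumes at `T = T_♮(1)`.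
HONEST FRAMING.  Flat finite-torus linear algebra in our frame; nothing about Bałaban's minimisers, (P♮) at `W ≠ 1`, (ML_w),
T-E_w or NE3 is asserted; the CURVED decomposition `ker d(avg^k)(W) = D_WΞ₀ ⊕ T_♮(W)` is NOT in this file; NE3 NOT proved; spine
PROVED 0∕9; finite T⁴ rung (B)+1 — NOT infinite volume, NOT mass gap, NOT BetaPertH, NOT Clay.  ABSOLUTE RULE kept: no printed
sentence is a hypothesis (context only: [Balaban1985Averaging] (42), (47)–(48) p. 25, (120)–(125) pp. 35–36;
[Balaban1985Variational] (83) p. 290).  PLACEMENT: `Summits/QuantumFields/BalabanUV/`; imports file 2 (hence file 1, Φ1a∕Φ1b,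
leaf-01-g5's (U), `NE3LandauOrbit`) BY NAME; moves nothing.  HONEST DEPENDENCY: continuum YM on T⁴ ⇐ BetaPertH ∧ nine spine
estimates (0/9 proved); BetaPertH ⇐ (D1) ∧ (D4) ∧ CAP+tail; G-an2-4 gates asym, D1 and NE2/3/4.
-/

set_option autoImplicit false

open scoped BigOperators Matrix.Norms.L2Operator
open Finset

namespace Summit.QuantumFields.BalabanUV.T4Continuum.NE3FrameFreeDecomposition

open Literature.MathematicalPhysics.QuantumFieldTheory.Balaban1983to89
open B7Prop1Explicit B7Prop3Flat MatrixNorms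
open T4AveragingDeficitWall (IsSkewDir)
open T4AveragingDeficitWallBoundary (periodBox mem_periodBox)
open AveragingDeficitPeriodicCounting (IsPeriodicDir)
open AveragingDeficitMultiLevelPrep (TangentIter)
open MinimalActionWitness (flatCfg)
open SmoothRefineNeutral (Tcoarse)
open NE3TangentNoGoWords (dPot)
open NE3TangentFlatStructure (framePot tangentIter_flat_iff_iterate dPot_add_period Tcoarse_sub)
open NE3FramePotGauge (frameKill frameKill_corner frameKill_add_period framePot_add_frameKill iterate_Tcoarse_add_dPot_of_corner
  framePot_add_dPot_of_corner iterate_bmean_apply framePot_dPot framePot_add)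
open NE3FrameFreeSlice (frameFreeBlockLandau)
open NE3FrameFreeSliceUnique (dPot_eq_zero_of_mem_frameFreeBlockLandau)
open NE3CovariantCalculus (hsR hsR_add_left hsR_self)
open NE3CoercivityScaling (flatDiv)
open NE3FrameFreeDecompositionPrep
open NE3CornerGaugeSpace (cornerGaugeSpace mem_cornerGaugeSpace_iff exists_orthogonal blockConst_of_orthogonal dPot_add_pi)

noncomputable section

variable {d : ℕ} {n : Type*} [Fintype n] [DecidableEq n]

/-! ## §9 Linearity of the slice conditions -/

/-- The iterated contour average is additive: subtraction. [folklore] -/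
theorem iterate_Tcoarse_sub (L : ℕ) : ∀ (j : ℕ) (A B : Site d → Fin d → Matrix n n ℂ),
    (Tcoarse L)^[j] (fun y μ => A y μ - B y μ) = fun z κ => (Tcoarse L)^[j] A z κ - (Tcoarse L)^[j] B z κ
  | 0, _, _ => rfl
  | j + 1, A, B => by
      have h1 : Tcoarse L (fun y μ => A y μ - B y μ) = fun z κ => Tcoarse L A z κ - Tcoarse L B z κ :=
        funext fun z => funext fun κ => Tcoarse_sub L A B z κ
      rw [Function.iterate_succ_apply, h1, iterate_Tcoarse_sub L j]
      rfl

/-- The frame potential is additive: subtraction. [folklore] -/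
theorem framePot_sub (L k : ℕ) (A B : Site d → Fin d → Matrix n n ℂ) (z : Site d) :
    framePot L k (fun y μ => A y μ - B y μ) z = framePot L k A z - framePot L k B z := by
  have h := framePot_add L k (fun y μ => A y μ - B y μ) B z
  have hAB : (fun y μ => (fun y μ => A y μ - B y μ) y μ + B y μ) = A := funext fun y => funext fun μ => sub_add_cancel _ _
  rw [hAB] at h
  rw [h, add_sub_cancel_right]

omit [Fintype n] [DecidableEq n] in
/-- The flat divergence is additive: subtraction. [folklore] -/
theorem flatDiv_sub (A B : Site d → Fin d → Matrix n n ℂ) (x : Site d) :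
    flatDiv (fun y μ => A y μ - B y μ) x = flatDiv A x - flatDiv B x := by
  simp only [flatDiv, ← Finset.sum_sub_distrib]
  refine Finset.sum_congr rfl fun μ _ => ?_
  abel

/-- **THE SLICE IS A SUBSPACE**: `frameFreeBlockLandau L N k` is closed under subtraction (`L ≥ 1`). [folklore] -/
theorem sub_mem_frameFreeBlockLandau {L N k : ℕ} (hL : 1 ≤ L) {X X' : Site d → Fin d → Matrix n n ℂ}
    (hX : X ∈ frameFreeBlockLandau (d := d) (n := n) L N k) (hX' : X' ∈ frameFreeBlockLandau (d := d) (n := n) L N k) :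
    (fun y μ => X y μ - X' y μ) ∈ frameFreeBlockLandau (d := d) (n := n) L N k := by
  obtain ⟨hs, hP, hT, hF, hD⟩ := hX
  obtain ⟨hs', hP', hT', hF', hD'⟩ := hX'
  refine ⟨fun x μ => (skewAdjoint _).sub_mem (hs x μ) (hs' x μ), fun x κ μ => by simp only [hP x κ μ, hP' x κ μ], ?_,
    fun z => by rw [framePot_sub, hF z, hF' z, sub_zero], fun z => ?_⟩
  · have h1 := (tangentIter_flat_iff_iterate hL (k - 1) X).mp hT
    have h2 := (tangentIter_flat_iff_iterate hL (k - 1) X').mp hT'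
    refine (tangentIter_flat_iff_iterate hL (k - 1) _).mpr ?_
    rw [iterate_Tcoarse_sub, h1, h2]
    funext z κ
    simp
  · obtain ⟨c, hc⟩ := hD z
    obtain ⟨c', hc'⟩ := hD' z
    exact ⟨c - c', fun v hv hv0 => by rw [flatDiv_sub, hc v hv hv0, hc' v hv hv0]⟩

/-! ## §10 (D) Uniqueness of the decomposition (over leaf-01-g5's trivial intersection) -/

/-- **(D) UNIQUENESS OF THE FRAME-FREE DECOMPOSITION**: two corner-trivial periodic gauges `ξ₁, ξ₂` that both move `Y`
into the slice have the same coboundary (hence the same slice component) (`L, N ≥ 1`; the trivial intersection is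
leaf-01-g5's `NE3FrameFreeSliceUnique.dPot_eq_zero_of_mem_frameFreeBlockLandau`). [folklore] -/
theorem frameFree_decomposition_unique {L N k : ℕ} (hL : 1 ≤ L) (hN : 1 ≤ N)
    {Y : Site d → Fin d → Matrix n n ℂ} {ξ₁ ξ₂ : Site d → Matrix n n ℂ}
    (hξ₁P : ∀ (x : Site d) (κ : Fin d), ξ₁ (x + ((N * L ^ k : ℕ) : ℤ) • e κ) = ξ₁ x)
    (hξ₁0 : ∀ w : Site d, ξ₁ (((L ^ k : ℕ) : ℤ) • w) = 0)
    (hξ₂P : ∀ (x : Site d) (κ : Fin d), ξ₂ (x + ((N * L ^ k : ℕ) : ℤ) • e κ) = ξ₂ x)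
    (hξ₂0 : ∀ w : Site d, ξ₂ (((L ^ k : ℕ) : ℤ) • w) = 0)
    (h₁ : (fun x μ => Y x μ + dPot ξ₁ x μ) ∈ frameFreeBlockLandau (d := d) (n := n) L N k)
    (h₂ : (fun x μ => Y x μ + dPot ξ₂ x μ) ∈ frameFreeBlockLandau (d := d) (n := n) L N k) :
    dPot ξ₁ = dPot ξ₂ := by
  have hsub := sub_mem_frameFreeBlockLandau hL h₁ h₂
  have hfun : (fun y μ => (fun x μ => Y x μ + dPot ξ₁ x μ) y μ - (fun x μ => Y x μ + dPot ξ₂ x μ) y μ)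
      = dPot (fun x => ξ₁ x - ξ₂ x) := by
    funext y μ
    simp only [dPot]
    abel
  rw [hfun] at hsub
  have h0 := dPot_eq_zero_of_mem_frameFreeBlockLandau hL hN (ξ := fun x => ξ₁ x - ξ₂ x)
    (fun x κ => by simp only [hξ₁P, hξ₂P]) (fun w => by simp only [hξ₁0, hξ₂0, sub_self]) hsub
  funext x μ
  have := congr_fun (congr_fun h0 x) μ
  simp only [dPot, Pi.zero_apply] at this
  rw [← sub_eq_zero]
  simp only [dPot]
  rw [← this]
  abel

/-! ## §11 (E) EXISTENCE: every flat k-fold tangent direction is `dPot` of a corner-trivial gauge plus a slice element -/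

/-- **(E) THE FRAME-FREE DECOMPOSITION — EXISTENCE.**  For `L, N, k ≥ 1`, `(L^k)^d ≥ 2` and a skew, `(N·L^k)`-periodic
direction `Y` tangent to the `k`-fold flat average (`TangentIter L (k−1) flatCfg Y`), there is a 𝔲(n)-valued,
`(N·L^k)`-periodic, CORNER-TRIVIAL (`ξ (L^k•w) = 0`) gauge `ξ` with `Y + dPot ξ ∈ frameFreeBlockLandau L N k`.
Construction: `ξ = frameKill L k Y + η` where `η ∈ Ξ₀₀(N·L^k, L^k)` is the Riesz vector of the projection step
(`NE3CornerGaugeSpace.exists_orthogonal`) applied to the frame-free representative `Y + dPot (frameKill L k Y)`; frame-freeness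
survives (`framePot_add_dPot_of_corner`: `η` has zero block means), tangency survives (`iterate_Tcoarse_add_dPot_of_corner`), and
orthogonality to `dPot Ξ₀₀` is the blockwise-constant divergence (`blockConst_of_orthogonal`). [folklore] -/
theorem exists_cornerGauge_mem_frameFreeBlockLandau {L N k : ℕ} (hL : 1 ≤ L) (hN : 1 ≤ N) (hk : 1 ≤ k)
    (hMd : 2 ≤ (L ^ k) ^ d) {Y : Site d → Fin d → Matrix n n ℂ} (hYs : IsSkewDir Y)
    (hYP : IsPeriodicDir Y ((N * L ^ k : ℕ) : ℤ)) (hT : TangentIter L (k - 1) flatCfg Y) :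
    ∃ ξ : Site d → Matrix n n ℂ, (∀ x : Site d, ξ x ∈ skewAdjoint (Matrix n n ℂ))
      ∧ (∀ (x : Site d) (κ : Fin d), ξ (x + ((N * L ^ k : ℕ) : ℤ) • e κ) = ξ x)
      ∧ (∀ w : Site d, ξ (((L ^ k : ℕ) : ℤ) • w) = 0)
      ∧ (fun x μ => Y x μ + dPot ξ x μ) ∈ frameFreeBlockLandau (d := d) (n := n) L N k := by
  have hM : 1 ≤ L ^ k := Nat.one_le_pow _ _ hL
  have hP : 1 ≤ N * L ^ k := Nat.one_le_iff_ne_zero.mpr (Nat.mul_ne_zero (by omega) (by omega))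
  have hcast : ((L : ℤ) ^ k) = ((L ^ k : ℕ) : ℤ) := by push_cast; ring
  have hcastP : ((L : ℤ) ^ k * (N : ℤ)) = ((N * L ^ k : ℕ) : ℤ) := by push_cast; ring
  -- tangency as a kernel statement
  have hT' : (Tcoarse L)^[k] Y = 0 := by
    have h := (tangentIter_flat_iff_iterate hL (k - 1) Y).mp hT
    rwa [Nat.sub_add_cancel hk] at h
  -- Step 1: the frame-killing gauge
  set ξ₁ : Site d → Matrix n n ℂ := frameKill L k Y with hξ₁_def
  have hYP' : ∀ (y : Site d) (τ μ : Fin d), Y (y + ((L : ℤ) ^ k * (N : ℤ)) • e τ) μ = Y y μ := by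
    intro y τ μ; rw [hcastP]; exact hYP y τ μ
  have hξ₁P : ∀ (x : Site d) (κ : Fin d), ξ₁ (x + ((N * L ^ k : ℕ) : ℤ) • e κ) = ξ₁ x := by
    intro x κ; rw [← hcastP]; exact frameKill_add_period hL k hYP' x κ
  have hξ₁0 : ∀ w : Site d, ξ₁ (((L ^ k : ℕ) : ℤ) • w) = 0 := by
    intro w; rw [← hcast]; exact frameKill_corner hL k Y w
  have hξ₁s : ∀ x : Site d, ξ₁ x ∈ skewAdjoint (Matrix n n ℂ) := fun x => frameKill_mem_skewAdjoint L k hYs x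
  set Y₁ : Site d → Fin d → Matrix n n ℂ := fun x μ => Y x μ + dPot ξ₁ x μ with hY₁_def
  have hF₁ : ∀ z : Site d, framePot L k Y₁ z = 0 := fun z => framePot_add_frameKill hL hMd Y z
  have hY₁P : IsPeriodicDir Y₁ ((N * L ^ k : ℕ) : ℤ) := fun x κ μ => by
    simp only [hY₁_def, hYP x κ μ, dPot_add_period hξ₁P x κ μ]
  have hY₁s : IsSkewDir Y₁ := fun x μ => (skewAdjoint _).add_mem (hYs x μ) (dPot_mem_skewAdjoint hξ₁s x μ)
  -- Step 2: the projection onto `dPot Ξ₀₀`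
  obtain ⟨η, hη, horth⟩ := exists_orthogonal (d := d) (n := n) hP (L ^ k) Y₁
  obtain ⟨hηP, hη0, hηb, hηs⟩ := mem_cornerGaugeSpace_iff.mp hη
  set X : Site d → Fin d → Matrix n n ℂ := fun x μ => Y₁ x μ + dPot η x μ with hX_def
  have hXP : IsPeriodicDir X ((N * L ^ k : ℕ) : ℤ) := fun x κ μ => by
    simp only [hX_def, hY₁P x κ μ, dPot_add_period hηP x κ μ]
  have hXs : IsSkewDir X := fun x μ => (skewAdjoint _).add_mem (hY₁s x μ) (dPot_mem_skewAdjoint hηs x μ)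
  -- the final gauge
  set ξf : Site d → Matrix n n ℂ := fun x => ξ₁ x + η x with hξf_def
  have hξfs : ∀ x : Site d, ξf x ∈ skewAdjoint (Matrix n n ℂ) := fun x => (skewAdjoint _).add_mem (hξ₁s x) (hηs x)
  have hξfP : ∀ (x : Site d) (κ : Fin d), ξf (x + ((N * L ^ k : ℕ) : ℤ) • e κ) = ξf x := fun x κ => by
    simp only [hξf_def, hξ₁P, hηP]
  have hξf0 : ∀ w : Site d, ξf (((L ^ k : ℕ) : ℤ) • w) = 0 := fun w => by
    simp only [hξf_def, hξ₁0, hη0, add_zero]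
  refine ⟨ξf, hξfs, hξfP, hξf0, ?_⟩
  have hfin : (fun x μ => Y x μ + dPot ξf x μ) = X := by
    funext x μ
    simp only [hX_def, hY₁_def, hξf_def, dPot]
    abel
  rw [hfin]
  refine ⟨hXs, hXP, ?_, fun z => ?_, ?_⟩
  · -- tangency: corner-trivial gauges do not move `(Tcoarse L)^[k]`
    refine (tangentIter_flat_iff_iterate hL (k - 1) X).mpr ?_
    rw [Nat.sub_add_cancel hk]
    have hcorner : ∀ w : Site d, ξf (((L : ℤ) ^ k) • w) = 0 := by
      intro w; rw [hcast]; exact hξf0 w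
    have h := iterate_Tcoarse_add_dPot_of_corner hL k Y hcorner
    rw [hT', hfin] at h
    exact h
  · -- frame-freeness: `η` has zero block means
    have hη0' : ∀ w : Site d, η (((L : ℤ) ^ k) • w) = 0 := by intro w; rw [hcast]; exact hη0 w
    rw [hX_def, framePot_add_dPot_of_corner hL k Y₁ hη0' z, hF₁ z, zero_add, iterate_bmean_apply hL, hηb z, smul_zero]
  · -- blockwise-constant divergence off the corners: orthogonality to `dPot Ξ₀₀`
    have hXP' : IsPeriodicDir X ((L ^ k * N : ℕ) : ℤ) := by rw [Nat.mul_comm]; exact hXP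
    refine blockConst_of_orthogonal hM hN hXs hXP' fun ζ hζP hζ0 hζb hζs => ?_
    rw [Nat.mul_comm] at hζP ⊢
    exact horth ζ (mem_cornerGaugeSpace_iff.mpr ⟨hζP, hζ0, hζb, hζs⟩)

end

end Summit.QuantumFields.BalabanUV.T4Continuum.NE3FrameFreeDecomposition
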